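import Summits.BirchSwinnertonDyer.Rank1Residual.Additive.QuadraticTwistTowerNoPTorsion
import Summits.BirchSwinnertonDyer.Rank1Residual.Additive.StrictSignedLocalPreimageCard
import Summits.BirchSwinnertonDyer.Rank1Residual.Additive.SubSelmerControlZeroExact
import Literature.NumberTheory.EllipticCurves.IwasawaSelmerModuleFiniteProofs
import Literature.NumberTheory.EllipticCurves.IwasawaSelmerTorsionProofs
import Literature.NumberTheory.EllipticCurves.IwasawaEulerCharRankZeroProofs
import HarnessLib

/-!
# The strict signed dual `X^{ε,str}(E/K_∞)` is ALWAYS finitely generated over `Λ`, and is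
# `Λ`-TORSION with `f(0) ≠ 0` as soon as `A₀ = h₀⁻¹(Sel^{ε,str}(E/K_∞))` is finite
# (cell `b2b-bsdres`, CLASS-CLOSURE lane, class O10 — x1b GEN 43, class lead; file 110 of the series:
# two of the four `Λ`-module inputs of the (C3_η) Selmer side — `X` finitely generated (DISCHARGED
# outright), `X` torsion and `f(0) ≠ 0` (REDUCED to one finiteness statement at the bottom layer,
# Greenberg Thm. 1.4 / Lemma 4.2 style) — for Kobayashi's STRICT signed structure in `W`-coordinates)

HONEST FRAMING (cell `b2b-bsdres`, run/shared/lean/b2b/bsd-rank1-residual/, verbatim in every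
file): the goal of the cell is to DELETE the COMBINATION-SHAPED residual classes of the
Birch–Swinnerton-Dyer formula for ALL analytic-rank `≤ 1` elliptic curves over `ℚ` — "full BSD
formula for every rank `≤ 1` curve in class `C`" assembled STRICTLY from published theorems — so
that the rank-`≤ 1` remainder becomes exactly the CONSTRUCTION-SHAPED classes, which are TYPED
(missing-input `Prop`s), NOT attempted. This is not "finishing BSD". CLASS-CLOSURE lane: prove
what is provable now; shrink each hard class to its core with data; no claim beyond stated classes;
research routes on CONSTRUCTION-SHAPED X12 / O10; census / instrument output = EVIDENCE / conjecture
items, NEVER a Literature fact; `RESIDUAL-MAP.md` marks change only by signed lines. THIS FILE: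
TOOL THEOREMS ONLY (generic `Λ`-algebra and Galois-cohomology bookkeeping over the tree's objects)
— no definition, no named Literature fact, no Summits-side fact `def … : Prop`, no `sorry`, axioms
standard; nothing is booked; no label / mark / count / sub-cell moves; (C1_η), (C2_η-GZ), (C3_η)
stay typed as filed (cc-typer-6's pen); O10 stays OPEN / CONSTRUCTION-SHAPED; nothing about
`BSD(W, p)` of any pair is claimed.

## What

Every consumer of the strict signed dual datum `D : StrictSignedSelmerDualData W κ E γ ε` (p17's
FILE 2a/2b; x1b files 42–109) carries FOUR `Λ`-module inputs on `X = D.X = Hom(Sel^{ε,str}_∞, ℚ/ℤ)`: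
`[Module.Finite Λ X]`, `X` torsion (`hX`), no non-trivial finite submodule (`hnf`), `char(X) = (f)`
with `f(0) ≠ 0` (`hf`, `h0`). This file: §1 (ANY `conj_γ`-stable family `S_∞ ≤ Sel_{p^∞}(E/K_∞)`
with a Pontryagin-dual pair `(S_∞, conj_γ − 1) ↔ X`, any number field, any `ℤ_p`-extension with
topological generator `γ`): `X` is finitely generated over `Λ` (the tree's Nakayama lemma for duals
fed with the finiteness of `Sel_∞[p]^γ ⊇ S_∞[p]^γ`); `S_∞^γ` finite ⟹ `X` torsion (Greenberg's
"exercise" with `#S_∞^γ · X ⊆ TX`); `A₀ = h₀⁻¹(S_∞)` finite ⟹ `S_∞^γ` finite (every `γ`-fixed class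
is a restriction from `K_0`, Greenberg Lemma 3.2 — no `E(K_∞)[p^∞] = 0` needed) ⟹ `f(0) ≠ 0` for
every generator of `char(X)` (Greenberg Lemma 4.2). §2 (Kobayashi's STRICT signed structure, any
`K`, `κ`, model `E`, sign `ε`): **`X^{ε,str}(E/K_∞)` is finitely generated over `Λ`, UNCONDITIONALLY**
(`StrictSignedSelmerDualData.moduleFinite`: the instance argument of files 42–109 is discharged);
**`A₀ = h₀⁻¹(Sel^{ε,str}(E/K_∞))` finite ⟹ `X^{ε,str}` torsion, `char = (f)` with `f(0) ≠ 0`**, and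
conversely granted `hnf` + `E(K_∞)[p^∞] = 0` (file 42). §3 (the quadratic TWIST `W` of a good
supersingular `a_p = 0` curve over `ℚ`, model `ℚ_p`, `p ≥ 3`; `A₀ = Sel^{loc,∞}(W/ℚ)` by B2, files
47/55): **`Sel^{loc,∞}(W/ℚ)` finite ⟺ (`X^{ε,str}(W/ℚ_∞)` torsion ∧ `∃ f, char = (f) ∧ f(0) ≠ 0`)**
granted `hnf`. So on the Selmer side of the (C3_η) derivation (file 108) the inputs `Module.Finite`,
`hX`, `h0` are: one DISCHARGED, two EQUIVALENT to "`Sel^{loc,∞}(W/ℚ)` is finite"; `hnf` remains the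
(R2) input. NOT proved: that `Sel^{loc,∞}(W/ℚ)` is finite in rank one ((C1_η)-strength information
at `p`, Kobayashi Thm. 2.2 for the twist); (C1_η), (C2_η-GZ), (C3_η) as typed; any `BSD(W, p)`.

References: [GreenbergLNM1716] §1 p. 60 (Nakayama; "`X/TX` finite ⟹ `X` torsion", p. 61, proof of
Thm. 1.4), §3 Lemma 3.1–3.2 (p. 86), §4 Lemma 4.2 (p. 102); [Kobayashi2003] Def. 2.1 (p. 5),
Thm. 2.2 (p. 5; the statement whose f.g. half is proved here for the strict structure), Lemma 9.1
(p. 25); [Lang1990] Ch. 5 §1 (Nakayama's lemma).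
-/

noncomputable section

open scoped Classical

open WeierstrassCurve Literature.NumberTheory.EllipticCurves Literature.NumberTheory.GaloisRepresentations
  Literature.NumberTheory.EllipticCurves.IwasawaAlgebra Literature.NumberTheory.EllipticCurves.IwasawaDual
  Literature.NumberTheory.EllipticCurves.Kobayashi2003 ZpExtension

universe u

namespace Summit.BirchSwinnertonDyer.Rank1Residual.Additive

namespace SubSelmerControlZero

/-! ## §1a `Λ`-algebra: `S^{ψ=0}` finite ⟹ `X` torsion (and `f(0) ≠ 0`) -/
section Algebra

variable (p : ℕ) [Fact p.Prime] {S : Type*} [AddCommGroup S] {ψ : AddMonoid.End S}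
  {X : Type u} [AddCommGroup X] [Module (IwasawaAlgebra p) X]
  {toDual : X →+ (S →+ AddCircle (1 : ℚ))}

/-- **`S^{ψ=0}` finite ⟹ `X` is `Λ`-torsion** for a Pontryagin-dual pair `(S, ψ) ↔ X`
(`X ≅ Hom(S, ℚ/ℤ)`, `T ↔ ψ`) with `X` finitely generated: `N = #S^{ψ=0}` kills `ker ψ`, so
`N · X ⊆ T · X` (`IsDualPair.exists_nsmul_eq_X_smul`, the untopologised `(X/TX)^∨ = S[ψ]`), and a
finitely generated `Λ`-module with `N X ⊆ TX`, `N ≠ 0`, is torsion (Greenberg's "exercise",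
`isTorsion_of_forall_nsmul_eq_X_smul`). [cite: GreenbergLNM1716, §1 p. 61 (proof of Thm. 1.4)] -/
theorem isTorsion_of_finite_endInvariants [Module.Finite (IwasawaAlgebra p) X]
    (h : IsDualPair p ψ toDual) (hfin : Finite (endInvariants ψ)) :
    Module.IsTorsion (IwasawaAlgebra p) X := by
  have hN0 : Nat.card (endInvariants ψ) ≠ 0 := Nat.card_pos.ne'
  refine IwasawaDual.isTorsion_of_forall_nsmul_eq_X_smul hN0 fun x ↦ h.exists_nsmul_eq_X_smul ?_ x
  intro s hs
  have hs' : s ∈ endInvariants ψ := (mem_endInvariants_iff ψ s).mpr hs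
  have h1 : Nat.card (endInvariants ψ) • (⟨s, hs'⟩ : endInvariants ψ) = 0 := card_nsmul_eq_zero'
  have h2 := congrArg Subtype.val h1
  simpa using h2

/-- **`S^{ψ=0}` finite ⟹ `X` torsion AND `ord_T f = 0`, `f(0) ≠ 0`** for every generator `f` of
`char(X)` (dual pair, `X` finitely generated): the previous theorem and Greenberg's Lemma 4.2
(`IsDualPair.order_charGenerator_eq_zero_of_finite_endInvariants`).
[cite: GreenbergLNM1716, §1 p. 61 and §4 Lemma 4.2 (p. 102)] -/
theorem isTorsion_and_constantCoeff_ne_zero_of_finite_endInvariants [Module.Finite (IwasawaAlgebra p) X]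
    (h : IsDualPair p ψ toDual) (hfin : Finite (endInvariants ψ)) :
    Module.IsTorsion (IwasawaAlgebra p) X ∧
      ∀ f : IwasawaAlgebra p, Module.charIdeal (IwasawaAlgebra p) X = Ideal.span {f} →
        f.order = 0 ∧ PowerSeries.constantCoeff f ≠ 0 :=
  ⟨isTorsion_of_finite_endInvariants p h hfin, fun f hf ↦
    h.order_charGenerator_eq_zero_of_finite_endInvariants (isTorsion_of_finite_endInvariants p h hfin)
      f hf hfin⟩

/-- The characteristic ideal of ANY `Λ`-module is principal (`Λ` is a UFD; the tree's
`charIdeal_isPrincipal_holds`): a generator `f` with `char(X) = (f)` always exists, so the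
hypothesis shape `(hf : char = Ideal.span {f})` of the consumers is never vacuous. [cite: Washington1997, §13.2] -/
theorem exists_charIdeal_eq_span (X : Type u) [AddCommGroup X] [Module (IwasawaAlgebra p) X] :
    ∃ f : IwasawaAlgebra p, Module.charIdeal (IwasawaAlgebra p) X = Ideal.span {f} :=
  (charIdeal_isPrincipal_holds p X).principal

end Algebra

/-! ## §1b Sub-Selmer families: `X` finitely generated; `A₀` finite ⟹ `S_∞^γ` finite -/
section Selmer

variable {K : Type u} [Field K] [NumberField K] (W : WeierstrassCurve K) {p : ℕ} [Fact p.Prime]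
  {κ : ZpExtension K p} {γ : Field.absoluteGaloisGroup K}

/-- **`X` is finitely generated over `Λ` for EVERY `conj_γ`-stable family `S_∞ ≤ Sel_{p^∞}(E/K_∞)`
with a Pontryagin-dual pair** `(S_∞, ψ) ↔ X`, `ψ` acting as `conj_γ − 1`, `γ` a topological
generator of ANY `ℤ_p`-extension of a number field `K`, `E/K` elliptic: the tree's Nakayama lemma for
duals (`IsDualPair.module_finite`: `S_∞[p] ∩ ker ψ` finite suffices) with `S_∞[p]^γ ↪ Sel_∞[p]^γ`,
which is finite (`finite_setOf_selmerInfty_pTorsion_conjH1_eq_of_isTopGenerator`, Greenberg's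
"`X/𝔪X` is finite", any `p`, any reduction type, any `ℤ_p`-extension).
[cite: GreenbergLNM1716, §1 p. 60 (after Conj. 1.3)] [cite: Lang1990, Ch. 5 §1 (Nakayama's lemma)] -/
theorem moduleFinite_of_le_selmerInfty [W.IsElliptic] (hγ : κ.IsTopGenerator γ)
    {Sinf : AddSubgroup (W.subgroupH1 p κ.kerSubgroup)} (hle : Sinf ≤ W.selmerInfty κ)
    {ψ : AddMonoid.End Sinf}
    (hψ : ∀ s : Sinf, ((ψ s : Sinf) : W.subgroupH1 p κ.kerSubgroup) =
      W.conjH1 p κ.kerSubgroup γ (s : W.subgroupH1 p κ.kerSubgroup) - s)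
    {X : Type u} [AddCommGroup X] [Module (IwasawaAlgebra p) X]
    {toDual : X →+ (Sinf →+ AddCircle (1 : ℚ))} (hpair : IsDualPair p ψ toDual) :
    Module.Finite (IwasawaAlgebra p) X := by
  refine hpair.module_finite ?_
  have hfin := W.finite_setOf_selmerInfty_pTorsion_conjH1_eq_of_isTopGenerator κ hγ
  let ι : Sinf → W.selmerInfty κ := fun s ↦ ⟨(s : W.subgroupH1 p κ.kerSubgroup), hle s.2⟩
  have hι : Function.Injective ι := fun a b hab ↦ by
    have h : ((ι a : W.selmerInfty κ) : W.subgroupH1 p κ.kerSubgroup) = ι b := congrArg _ hab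
    exact Subtype.ext h
  refine Set.Finite.of_finite_image (hfin.subset ?_) hι.injOn
  rintro _ ⟨s, hs, rfl⟩
  obtain ⟨hs1, hs2⟩ := IwasawaDual.mem_piece.mp hs
  rw [pow_one] at hs1 hs2
  refine ⟨Subtype.ext ?_, ?_⟩
  · have h := congrArg Subtype.val hs1
    simpa [ι] using h
  · have h : ((ψ s : Sinf) : W.subgroupH1 p κ.kerSubgroup) = ((0 : Sinf) : W.subgroupH1 p κ.kerSubgroup) :=
      congrArg _ hs2
    rw [hψ, ZeroMemClass.coe_zero, sub_eq_zero] at h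
    exact h

/-- **`A₀ = h₀⁻¹(S_∞)` finite ⟹ `S_∞^γ` finite**, for any family `S_∞ ≤ H¹(K_∞, E[p^∞])` with `ψ`
acting as `conj_γ − 1` (`γ` a topological generator): every `ψ`-fixed class is `h₀ y` with `y ∈ A₀`
(Greenberg's Lemma 3.2, `coker h₀ = 0` onto the invariants since `cd_p ℤ_p = 1`; the tree's
`exists_layerToInfty_eq_of_mem_endInvariants`), and `h₀ y` determines the fixed class. No hypothesis
`E(K_∞)[p^∞] = 0` is needed in this direction. [cite: GreenbergLNM1716, §3 Lemma 3.2 (p. 86)] -/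
theorem finite_endInvariants_of_finite_comap (hγ : κ.IsTopGenerator γ)
    {Sinf : AddSubgroup (W.subgroupH1 p κ.kerSubgroup)} {ψ : AddMonoid.End Sinf}
    (hψ : ∀ s : Sinf, ((ψ s : Sinf) : W.subgroupH1 p κ.kerSubgroup) =
      W.conjH1 p κ.kerSubgroup γ (s : W.subgroupH1 p κ.kerSubgroup) - s)
    (hfin : Finite (Sinf.comap (W.layerToInfty κ 0))) : Finite (endInvariants ψ) := by
  have hex := fun s : endInvariants ψ ↦ exists_layerToInfty_eq_of_mem_endInvariants W hγ hψ s.2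
  choose y hyA hy using hex
  refine Finite.of_injective (fun s ↦ (⟨y s, hyA s⟩ : Sinf.comap (W.layerToInfty κ 0))) ?_
  intro a b hab
  have h : W.layerToInfty κ 0 (y a) = W.layerToInfty κ 0 (y b) := by
    have h' : ((⟨y a, hyA a⟩ : Sinf.comap (W.layerToInfty κ 0)) : W.subgroupH1 p (κ.layerSubgroup 0)) =
        ((⟨y b, hyA b⟩ : Sinf.comap (W.layerToInfty κ 0)) : W.subgroupH1 p (κ.layerSubgroup 0)) :=
      congrArg _ hab
    exact congrArg _ h'
  rw [hy a, hy b] at h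
  exact Subtype.ext (Subtype.ext h)

end Selmer

end SubSelmerControlZero

/-! ## §2 Kobayashi's STRICT signed structure in `W`-coordinates -/
section Strict

variable {K : Type u} [Field K] [NumberField K] (W : WeierstrassCurve K) {p : ℕ} [Fact p.Prime]
  (κ : ZpExtension K p) (E : Type u) [Field E] [Algebra K E] (ε : ℤˣ)

/-- **`X^{ε,str}(E/K_∞)` IS FINITELY GENERATED OVER `Λ`, unconditionally**: for every number field
`K`, elliptic `E/K`, prime `p`, `ℤ_p`-extension `κ` with topological generator `γ`, model `E`, sign
`ε`, and every strict signed dual datum `D` (p17's FILE 2a): `Module.Finite (IwasawaAlgebra p) D.X`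
— §1b at `S_∞ = Sel^{ε,str}(E/K_∞) ≤ Sel_{p^∞}(E/K_∞)`, `ψ = conj_γ − 1`, dual pair `isDualPair`.
The finite-generation half of Kobayashi's Thm. 2.2 for the strict structure, for free; it discharges
the instance argument `[Module.Finite (IwasawaAlgebra p) D.X]` of every consumer (files 42–109).
[cite: Kobayashi2003, Def. 2.1 and Thm. 2.2 (p. 5; the f.g. half)] [cite: GreenbergLNM1716, §1 p. 60] -/
theorem StrictSignedSelmerDualData.moduleFinite [W.IsElliptic] {γ : Field.absoluteGaloisGroup K}
    (hγ : κ.IsTopGenerator γ) (D : StrictSignedSelmerDualData W κ E γ ε) :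
    Module.Finite (IwasawaAlgebra p) D.X :=
  SubSelmerControlZero.moduleFinite_of_le_selmerInfty W hγ (strictSignedSelmerInfty_le_selmerInfty W κ E ε)
    (coe_conjStrictSignedSelmerInfty_sub_one_apply W κ E ε γ) (StrictSignedControlZero.isDualPair D hγ)

namespace StrictSignedControlZero

/-- **`A₀ = h₀⁻¹(Sel^{ε,str}(E/K_∞))` finite ⟹ `(Sel^{ε,str}_∞)^γ` finite** (§1b for the strict
signed family). [cite: GreenbergLNM1716, §3 Lemma 3.2 (p. 86)] -/
theorem finite_endInvariants_of_finite_comap {γ : Field.absoluteGaloisGroup K}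
    (hγ : κ.IsTopGenerator γ)
    (hfin : Finite ((strictSignedSelmerInfty W κ E ε).comap (W.layerToInfty κ 0))) :
    Finite (endInvariants (conjStrictSignedSelmerInfty W κ E ε γ - 1)) :=
  SubSelmerControlZero.finite_endInvariants_of_finite_comap W hγ
    (coe_conjStrictSignedSelmerInfty_sub_one_apply W κ E ε γ) hfin

/-- **`A₀ = h₀⁻¹(Sel^{ε,str}(E/K_∞))` finite ⟹ `X^{ε,str}(E/K_∞)` is `Λ`-TORSION** for every strict
signed dual datum `D` — Greenberg's Thm. 1.4 / Mazur for Kobayashi's strict signed structure (`A₀`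
plays the part of `Sel_E(F)`: it maps ONTO the `γ`-invariants of `Sel^{ε,str}_∞`); the route by which
`hX` of the consumers becomes a statement at level `0`.
[cite: GreenbergLNM1716, §1 Thm. 1.4 (p. 60) and its proof (p. 61)] [cite: Kobayashi2003, Thm. 2.2 (p. 5)] -/
theorem isTorsion_of_finite_comap [W.IsElliptic] {γ : Field.absoluteGaloisGroup K}
    (hγ : κ.IsTopGenerator γ) (D : StrictSignedSelmerDualData W κ E γ ε)
    (hfin : Finite ((strictSignedSelmerInfty W κ E ε).comap (W.layerToInfty κ 0))) :
    Module.IsTorsion (IwasawaAlgebra p) D.X := by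
  haveI := StrictSignedSelmerDualData.moduleFinite W κ E ε hγ D
  exact SubSelmerControlZero.isTorsion_of_finite_endInvariants p (isDualPair D hγ)
    (finite_endInvariants_of_finite_comap W κ E ε hγ hfin)

/-- **`A₀` finite ⟹ `f(0) ≠ 0` (and `ord_T f = 0`) for EVERY generator `f` of `char X^{ε,str}(E/K_∞)`**
(Greenberg's Lemma 4.2 on the dual pair of the strict structure).
[cite: GreenbergLNM1716, §4 Lemma 4.2 (p. 102)] -/
theorem order_eq_zero_and_constantCoeff_ne_zero_of_finite_comap [W.IsElliptic]
    {γ : Field.absoluteGaloisGroup K} (hγ : κ.IsTopGenerator γ) (D : StrictSignedSelmerDualData W κ E γ ε)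
    (hfin : Finite ((strictSignedSelmerInfty W κ E ε).comap (W.layerToInfty κ 0)))
    {f : IwasawaAlgebra p} (hf : D.charIdeal = Ideal.span {f}) :
    f.order = 0 ∧ PowerSeries.constantCoeff f ≠ 0 := by
  haveI := StrictSignedSelmerDualData.moduleFinite W κ E ε hγ D
  exact (SubSelmerControlZero.isTorsion_and_constantCoeff_ne_zero_of_finite_endInvariants p
    (isDualPair D hγ) (finite_endInvariants_of_finite_comap W κ E ε hγ hfin)).2 f hf

/-- **`A₀` finite ⟹ `∃ f, char X^{ε,str}(E/K_∞) = (f) ∧ f(0) ≠ 0`** (existence of the generator: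
`Λ` is a UFD, `charIdeal_isPrincipal_holds`). Together with `isTorsion_of_finite_comap` and
`StrictSignedSelmerDualData.moduleFinite`: of the consumers' four `Λ`-module inputs on `D` only the
absence of finite submodules (`hnf`, Kitajima–Otsuki) is not a consequence of "`A₀` finite".
[cite: GreenbergLNM1716, §4 Lemma 4.2 (p. 102)] [cite: Washington1997, §13.2] -/
theorem exists_charGenerator_constantCoeff_ne_zero_of_finite_comap [W.IsElliptic]
    {γ : Field.absoluteGaloisGroup K} (hγ : κ.IsTopGenerator γ) (D : StrictSignedSelmerDualData W κ E γ ε)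
    (hfin : Finite ((strictSignedSelmerInfty W κ E ε).comap (W.layerToInfty κ 0))) :
    ∃ f : IwasawaAlgebra p, D.charIdeal = Ideal.span {f} ∧ PowerSeries.constantCoeff f ≠ 0 := by
  obtain ⟨f, hf⟩ := SubSelmerControlZero.exists_charIdeal_eq_span p D.X
  exact ⟨f, hf, (order_eq_zero_and_constantCoeff_ne_zero_of_finite_comap W κ E ε hγ D hfin hf).2⟩

/-- **Conversely** (the tree's file 42/59 direction, restated next to its converse): `X^{ε,str}`
torsion with no finite submodule, `char = (f)`, `f(0) ≠ 0`, AND `E(K_∞)[p^∞] = 0` ⟹ `A₀` is finite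
(indeed `ord_p #Sel^{ε,str}(E/K_0) + ord_p #(A₀ ⧸ Sel^{ε,str}(E/K_0)) = ord_p f(0)`,
`SubSelmerControlZeroExact`). [cite: GreenbergLNM1716, §3 Lemma 3.1–3.2, §4 Lemma 4.2 (p. 102)]
[cite: Kobayashi2003, Lemma 9.1 (p. 25)] -/
theorem finite_comap_of_isTorsion [W.IsElliptic] {γ : Field.absoluteGaloisGroup K}
    (hγ : κ.IsTopGenerator γ) (D : StrictSignedSelmerDualData W κ E γ ε)
    (hX : Module.IsTorsion (IwasawaAlgebra p) D.X)
    (hB : FixedPoints.addSubgroup κ.kerSubgroup (W.geomPrimaryTorsion p) = ⊥)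
    (hnf : ∀ N : Submodule (IwasawaAlgebra p) D.X, Finite N → N = ⊥)
    {f : IwasawaAlgebra p} (hf : D.charIdeal = Ideal.span {f}) (h0 : PowerSeries.constantCoeff f ≠ 0) :
    Finite ((strictSignedSelmerInfty W κ E ε).comap (W.layerToInfty κ 0)) := by
  haveI := StrictSignedSelmerDualData.moduleFinite W κ E ε hγ D
  obtain ⟨hfinS, hfinQ, -⟩ := finite_and_padicValNat_card_add_eq W κ E ε hγ D hX hB hnf hf h0
  set A := (strictSignedSelmerInfty W κ E ε).comap (W.layerToInfty κ 0)
  set S0 := strictSignedSelmerLayer W κ E ε 0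
  have hle : S0 ≤ A := fun y hy ↦
    AddSubgroup.mem_comap.mpr (map_layerToInfty_strictSignedSelmerLayer_le W κ E ε 0 ⟨y, hy, rfl⟩)
  haveI : Finite (S0.addSubgroupOf A) :=
    Finite.of_equiv _ (AddSubgroup.addSubgroupOfEquivOfLe hle).toEquiv.symm
  exact (AddSubgroup.finite_iff_finite_and_finiteIndex (S0.addSubgroupOf A)).mpr
    ⟨inferInstance, AddSubgroup.finiteIndex_of_finite_quotient⟩

/-- **The EQUIVALENCE at the bottom layer.** For a strict signed dual datum `D` whose `X^{ε,str}` has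
no non-trivial finite `Λ`-submodule and with `E(K_∞)[p^∞] = 0`: `A₀ = h₀⁻¹(Sel^{ε,str}(E/K_∞))` is
finite IFF `X^{ε,str}` is `Λ`-torsion with a characteristic generator `f`, `f(0) ≠ 0`.
[cite: GreenbergLNM1716, §1 Thm. 1.4, §4 Lemma 4.2 (p. 102)] [cite: Kobayashi2003, Thm. 2.2 (p. 5), Lemma 9.1 (p. 25)] -/
theorem finite_comap_iff_isTorsion [W.IsElliptic] {γ : Field.absoluteGaloisGroup K}
    (hγ : κ.IsTopGenerator γ) (D : StrictSignedSelmerDualData W κ E γ ε)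
    (hB : FixedPoints.addSubgroup κ.kerSubgroup (W.geomPrimaryTorsion p) = ⊥)
    (hnf : ∀ N : Submodule (IwasawaAlgebra p) D.X, Finite N → N = ⊥) :
    Finite ((strictSignedSelmerInfty W κ E ε).comap (W.layerToInfty κ 0)) ↔
      Module.IsTorsion (IwasawaAlgebra p) D.X ∧
        ∃ f : IwasawaAlgebra p, D.charIdeal = Ideal.span {f} ∧ PowerSeries.constantCoeff f ≠ 0 :=
  ⟨fun hfin ↦ ⟨isTorsion_of_finite_comap W κ E ε hγ D hfin,
      exists_charGenerator_constantCoeff_ne_zero_of_finite_comap W κ E ε hγ D hfin⟩,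
    fun ⟨hX, _, hf, h0⟩ ↦ finite_comap_of_isTorsion W κ E ε hγ D hX hB hnf hf h0⟩

end StrictSignedControlZero

end Strict

/-! ## §3 The quadratic TWIST of a good supersingular curve over `ℚ` (model `ℚ_p`) -/

namespace StrictSignedControlZero
section Twist

variable {p : ℕ} [hp : Fact p.Prime] (κ : ZpExtension ℚ p) (W : WeierstrassCurve ℚ) [W.IsElliptic]
  (ε : ℤˣ)

/-- **`Sel^{loc,∞}(W/ℚ)` finite ⟹ `X^{ε,str}(W/ℚ_∞)` is finitely generated `Λ`-TORSION and every
characteristic generator has `f(0) ≠ 0`**, for `W/ℚ` elliptic with `C • W^{(c)} = V` (`c` a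
non-square), `M/ℤ_p` a good supersingular model of `V` over `ℚ̄_p`, `p ≥ 3`, ANY `ℤ_p`-extension `κ`
of `ℚ` with topological generator `γ`, any sign `ε`, ANY strict signed dual datum `D` (model `ℚ_p`):
`Sel^{loc,∞}(W/ℚ)` (classes over `ℚ` whose restriction to `ℚ_∞` lies in `Sel_{p^∞}(W/ℚ_∞)` and in
the strict signed Kummer condition cut out by `⋃ₙ W^{ε,str}(ℚ_n·ℚ_p)`) IS `A₀` (B2, file 47, with
(hS)/(htors) discharged for the twist, file 55), and §2 applies. [cite: GreenbergLNM1716, §1 Thm. 1.4, §3 Lemma 3.2, §4 Lemma 4.2 (p. 102)]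
[cite: Kobayashi2003, Def. 2.1 (p. 5), Thm. 2.2 (p. 5), Prop. 8.7 (p. 16)] -/
theorem moduleFinite_isTorsion_constantCoeff_ne_zero_of_finite_localPreimage_of_quadraticTwist
    (hp2 : p ≠ 2) {c : ℚ} (hc : ∀ q : ℚ, q ^ 2 ≠ c) (C : VariableChange ℚ)
    {V : WeierstrassCurve ℚ} [V.IsElliptic] (hCV : C • W.quadraticTwist c = V)
    (M : WeierstrassCurve ℤ_[p]) (hΔ : IsUnit M.Δ)
    (hA : M.hasseCoeff p ∈ IsLocalRing.maximalIdeal ℤ_[p])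
    (hVM : M.baseChange (AlgebraicClosure ℚ_[p]) = V.baseChange (AlgebraicClosure ℚ_[p]))
    {γ : Field.absoluteGaloisGroup ℚ} (hγ : κ.IsTopGenerator γ)
    (D : StrictSignedSelmerDualData W κ ℚ_[p] γ ε)
    (hfin : Finite ↥((W.selmerInfty κ ⊓
        ⨅ σ : Field.absoluteGaloisGroup ℚ,
          (localKummerOverOfEmb W p κ.kerSubgroup (closureEmb (K := ℚ) ℚ_[p])
              (⨆ m, strictSignedLocalPoints κ ℚ_[p] W ε m)).comap (W.conjH1 p κ.kerSubgroup σ)).comap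
        (W.layerToInfty κ 0))) :
    Module.Finite (IwasawaAlgebra p) D.X ∧ Module.IsTorsion (IwasawaAlgebra p) D.X ∧
      ∀ f : IwasawaAlgebra p, D.charIdeal = Ideal.span {f} →
        f.order = 0 ∧ PowerSeries.constantCoeff f ≠ 0 := by
  obtain ⟨S, hS⟩ := exists_finset_forall_not_mem_good W p
  have hA₀ := comap_layerToInfty_zero_strictSignedSelmerInfty_eq W κ ℚ_[p] ε S hS
    (eq_zero_of_prime_pow_smul_eq_zero_localFixedPointsOfEmb_kerSubgroup_of_quadraticTwist κ
      (closureEmb (K := ℚ) ℚ_[p]) hp2 W hc C hCV M hΔ hA hVM)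
  rw [← hA₀] at hfin
  exact ⟨StrictSignedSelmerDualData.moduleFinite W κ ℚ_[p] ε hγ D,
    isTorsion_of_finite_comap W κ ℚ_[p] ε hγ D hfin,
    fun f hf ↦ order_eq_zero_and_constantCoeff_ne_zero_of_finite_comap W κ ℚ_[p] ε hγ D hfin hf⟩

/-- **The same for the `p*`-twist `W` of a globally minimal good supersingular `a_p = 0` curve
`V`** (consumers' binders `C • W.quadraticTwist ((−1)^{p/2} p) = V`, `V.IsGloballyMinimal`,
`V.HasGoodReductionAtPrime p`, `V.frobeniusTrace p = 0`, `p ≥ 3`; the model from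
`exists_goodSupersingularPadicModel`). For `κ` cyclotomic, `ε = −1` this is the object of the
(C3_η) derivation: on its Selmer side (file 108) the inputs `[Module.Finite]`, `hX`, `h0` are now ONE
statement — "`Sel^{loc,∞}(W/ℚ)` is finite" — and `hnf`. [cite: GreenbergLNM1716, §1 Thm. 1.4, §4 Lemma 4.2 (p. 102)]
[cite: Kobayashi2003, Thm. 2.2 (p. 5), Prop. 8.7 (p. 16), Thm. 9.3 (p. 26)] -/
theorem moduleFinite_isTorsion_constantCoeff_ne_zero_of_finite_localPreimage_of_quadraticTwist_signedPrime
    (hp2 : p ≠ 2) (C : VariableChange ℚ) (V : WeierstrassCurve ℚ) [V.IsElliptic]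
    [V.IsGloballyMinimal] (hCV : C • W.quadraticTwist ((-1) ^ (p / 2) * p) = V)
    (hgood : V.HasGoodReductionAtPrime p) (hap : V.frobeniusTrace p = 0)
    {γ : Field.absoluteGaloisGroup ℚ} (hγ : κ.IsTopGenerator γ)
    (D : StrictSignedSelmerDualData W κ ℚ_[p] γ ε)
    (hfin : Finite ↥((W.selmerInfty κ ⊓
        ⨅ σ : Field.absoluteGaloisGroup ℚ,
          (localKummerOverOfEmb W p κ.kerSubgroup (closureEmb (K := ℚ) ℚ_[p])
              (⨆ m, strictSignedLocalPoints κ ℚ_[p] W ε m)).comap (W.conjH1 p κ.kerSubgroup σ)).comap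
        (W.layerToInfty κ 0))) :
    Module.Finite (IwasawaAlgebra p) D.X ∧ Module.IsTorsion (IwasawaAlgebra p) D.X ∧
      ∀ f : IwasawaAlgebra p, D.charIdeal = Ideal.span {f} →
        f.order = 0 ∧ PowerSeries.constantCoeff f ≠ 0 := by
  obtain ⟨M, hΔ, hA, hVM⟩ := exists_goodSupersingularPadicModel hp2 V hgood hap
  exact moduleFinite_isTorsion_constantCoeff_ne_zero_of_finite_localPreimage_of_quadraticTwist κ W ε
    hp2 (sq_ne_neg_one_pow_mul_prime hp.out (p / 2)) C hCV M hΔ hA hVM hγ D hfin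

/-- **The EQUIVALENCE for the `p*`-twist, granted `hnf`.** For `W`, `V`, `κ`, `γ`, `ε`, `D` as above
and `X^{ε,str}(W/ℚ_∞)` without non-trivial finite `Λ`-submodule (the Kitajima–Otsuki input (R2)):
**`Sel^{loc,∞}(W/ℚ)` is finite ⟺ `X^{ε,str}(W/ℚ_∞)` is `Λ`-torsion with a characteristic
generator `f`, `f(0) ≠ 0`** — `→` is this file, `←` is file 59
(`finite_localPreimage_and_natCard_eq_of_quadraticTwist_signedPrime`, which then also gives
`#Sel^{loc,∞}(W/ℚ) = p^{ord_p f(0)}`). [cite: GreenbergLNM1716, §1 Thm. 1.4, §4 Thm. 4.1 and Lemma 4.2 (p. 102)]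
[cite: Kobayashi2003, Thm. 2.2 (p. 5), Lemma 9.1 (p. 25), Thm. 9.3 (p. 26)] -/
theorem finite_localPreimage_iff_isTorsion_of_quadraticTwist_signedPrime
    (hp2 : p ≠ 2) (C : VariableChange ℚ) (V : WeierstrassCurve ℚ) [V.IsElliptic]
    [V.IsGloballyMinimal] (hCV : C • W.quadraticTwist ((-1) ^ (p / 2) * p) = V)
    (hgood : V.HasGoodReductionAtPrime p) (hap : V.frobeniusTrace p = 0)
    {γ : Field.absoluteGaloisGroup ℚ} (hγ : κ.IsTopGenerator γ)
    (D : StrictSignedSelmerDualData W κ ℚ_[p] γ ε)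
    (hnf : ∀ N : Submodule (IwasawaAlgebra p) D.X, Finite N → N = ⊥) :
    Finite ↥((W.selmerInfty κ ⊓
        ⨅ σ : Field.absoluteGaloisGroup ℚ,
          (localKummerOverOfEmb W p κ.kerSubgroup (closureEmb (K := ℚ) ℚ_[p])
              (⨆ m, strictSignedLocalPoints κ ℚ_[p] W ε m)).comap (W.conjH1 p κ.kerSubgroup σ)).comap
        (W.layerToInfty κ 0)) ↔
      Module.IsTorsion (IwasawaAlgebra p) D.X ∧
        ∃ f : IwasawaAlgebra p, D.charIdeal = Ideal.span {f} ∧ PowerSeries.constantCoeff f ≠ 0 := by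
  haveI := StrictSignedSelmerDualData.moduleFinite W κ ℚ_[p] ε hγ D
  refine ⟨fun hfin ↦ ?_, fun ⟨hX, f, hf, h0⟩ ↦ ?_⟩
  · obtain ⟨-, hX, hall⟩ :=
      moduleFinite_isTorsion_constantCoeff_ne_zero_of_finite_localPreimage_of_quadraticTwist_signedPrime
        κ W ε hp2 C V hCV hgood hap hγ D hfin
    obtain ⟨f, hf⟩ := SubSelmerControlZero.exists_charIdeal_eq_span p D.X
    exact ⟨hX, f, hf, (hall f hf).2⟩
  · exact (finite_localPreimage_and_natCard_eq_of_quadraticTwist_signedPrime κ W ε hp2 C V hCV hgood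
      hap hγ D hX hnf hf h0).1

end Twist

end StrictSignedControlZero

end Summit.BirchSwinnertonDyer.Rank1Residual.Additive

end
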